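import Summits.BirchSwinnertonDyer.BirchSwinnertonDyer.Theorems.WildThreeRankOneBSDpOfGlobalDivisibilityStepL
import Literature.NumberTheory.EllipticCurves.BSDSelmerPConverseRankOneRubinProofs
import HarnessLib

/-!
# The wild rank-one row at `3` with `ρ̄₃` onto (`W-ALL/2@3.O6.r1.surj`) CLASS-WIDE from TWO displayed
# Heegner-side statements + the rank-zero wild leaf: J₃ʷ (global `3^s`-divisibility of the derived Heegner
# points to depth `ord₃ ∏_ℓ c_ℓ(E) + v₃(c)`, the Kolyvagin side) and L₃ʷ (STEP L at slack `v₃(c)`, the IMC side)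
# (route-free class theorem; cell `bsd-wall`, D-0131 (3) M-UTD, seat `bsd-wall-utd-p3` gen 1; file 3 of 3)

ROUTE-FREE (imports no `Theses.*`). Files 1–2 (`WildThreeRankOneBSDpOfGlobalDivisibility{,StepL}.lean`,
p540800 / p542530) are PER DATUM. This file removes the datum: for EVERY `E` (globally minimal `W`) on
`ClassO6 W 3` with `ρ̄_{E,3}` onto and `r_an(E) = 1` — the cell `W-ALL/2@3.O6.r1.surj` of the wall table, NO
twin condition, NO `3`-adic tower binder — `BSDp W 3` follows from

* the PUBLISHED named facts (hypotheses): Gross–Zagier, Kolyvagin, Gross–Zagier–Kolyvagin, modularity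
  (`hasEntireLFunction_rat`, `exists_isNewformOf`), GZ86 I.(7.3), Hoffstein–Luo 1997 (an odd Heegner `d_K`
  with `L(E^{d_K},1) ≠ 0`), parity (`even_analyticRank_iff_rootNumber_eq_one`), Heegner points over `K`
  (`exists_isHeegnerPoint`), Matar–Nekovář 2019 Thm. 0.7/§0.11 (Kolyvagin's structure theorem, upper form,
  irreducible image, no reduction binder);
* TWO DISPLAYED research statements, quantified over the row and over every odd Heegner frame at level `N_E`:
  **J₃ʷ** (`hJ`) — every derived Heegner point `P_n` on the frame `(Dt, H.β, ι)` is `3^{s′}`-divisible in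
  `E(K[n])` for all `s′ ≤ ord₃ ∏_ℓ c_ℓ(E) + v₃(c(Dt))` (Jetchev 2008 Conj. 1.3 «`m_∞ ≥ ord₃(c·∏c_q)`», Σ-form,
  READ at an additive `3` with the Manin slack; in print nowhere — Jetchev's Thm. 1.4 is the MAX-form at
  `p ∤ N`, and at good ordinary `p ≥ 5` the Σ-form is known only through the main conjecture, W. Zhang 2014 /
  BCGS 2023); **L₃ʷ** (`hL`) — STEP L at slack `v₃(c)`: `2·ord₃[E(K):ℤP] ≤ ord₃ #Ш(E/K) + 2·ord₃ ∏_ℓ c_ℓ(E) + 2·v₃(c)`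
  for the Heegner point `P` of the frame (the IMC side: «anticyclotomic IMC ⊇ at the additive split `3` + BDP
  value + control», JSW 2017 §7.4.1 shape; what route UTD's cruxes #2–#4 produce on the twin cell);
* the rank-zero wild leaf `WAllExclAddWildRankZero` (hypothesis; `BSD₃` of the minimal model of `E^{d_K}`).

`bsdp_three_of_classO6_surj_rankOne_of_J3w_of_L3w_of_wAllExclAddWildRankZero`: parity ⟹ `w(E) = −1`;
Hoffstein–Luo ⟹ `K` with odd `d_K`, Heegner for `N_E`, `L(E^{d_K},1) ≠ 0`; `exists_isHeegnerPoint` ⟹ the frame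
`(Dt, H, ι)` and `P`; then file 2's `bsdp_three_of_globalDivisibility_of_stepL_of_wAllExclAddWildRankZero_of_surj`.
So the onto wild rank-one cell is, class-wide, TWO per-frame Heegner-side statements + leaf #6 away — the
currency certificate for a route pairing a Kolyvagin-side crux with an IMC-⊇-side crux on this cell.

PARTITION currency: habitat = `W-ALL/2@3.O6.r1.surj` = 3 894 classes (census R758: 3 893); conditional on
J₃ʷ, L₃ʷ and leaf #6 (all OPEN); classes closed: 0; «beyond-print theorem»: NO. HONEST FRAMING: CONDITIONAL
on every hypothesis; closes no item; BSD is not proved for any curve by this file. No definition, no named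
fact, no `sorry`.

References: [Jetchev2008] Conj. 1.3, Thm. 1.4, Cor. 1.5 (p. 812); [MatarNekovar2019] Thm. 0.7, §0.11;
[McCallumLMS1991] §5 Cor. 5.6; [HoffsteinLuo1997] Theorem (§1); [JetchevSkinnerWan2017] §7.4.1
(arXiv:1512.06894 p. 30); [GrossZagier1986] Thm. I.(6.3), V.§2; [WZhang2014] Thm. 1.1; [BCGS2023] Thm. 2.
-/

noncomputable section

open scoped Classical

set_option linter.dupNamespace false
set_option autoImplicit false

namespace Summit.BirchSwinnertonDyer.BirchSwinnertonDyer.Theorems.SchneiderFree.Exact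

open WeierstrassCurve NumberField IsDedekindDomain Field
  Literature.NumberTheory.EllipticCurves
  Literature.NumberTheory.EllipticCurves.ModularForms
  Literature.NumberTheory.EllipticCurves.Rank1Residual
  Literature.NumberTheory.EllipticCurves.KrizLi2019
  Summit.BirchSwinnertonDyer.Rank1Residual
  Summit.BirchSwinnertonDyer.Rank1Residual.Additive
  Summit.BirchSwinnertonDyer.Rank1Residual.X11b
  Summit.BirchSwinnertonDyer.Rank1Residual.X11b.Three

/-- **`W-ALL/2@3.O6.r1.surj` class-wide from J₃ʷ + L₃ʷ + the rank-zero wild leaf.** For EVERY globally minimal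
`W` on `ClassO6 W 3` with `ρ̄_{E,3}` onto and `r_an = 1`: the published named facts (hypotheses: Gross–Zagier,
Kolyvagin, GZK, modularity ×2, GZ86 I.(7.3), Hoffstein–Luo, parity, Heegner points over `K`, Matar–Nekovář
0.7/§0.11), the two DISPLAYED per-frame research statements **J₃ʷ** (`hJ`: global `3^{s′}`-divisibility of the
derived Heegner points to depth `ord₃ ∏_ℓ c_ℓ(E) + v₃(c)` on every odd Heegner frame at level `N_E` of the row —
Kolyvagin side) and **L₃ʷ** (`hL`: `IndexLowerBoundLeAt W 3 K P (v₃ c)` for the Heegner point of every such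
frame — IMC side), and the leaf `WAllExclAddWildRankZero` (hypothesis) give `BSDp W 3`. Proof: parity ⟹
`w(E) = −1`; Hoffstein–Luo ⟹ an odd Heegner `d_K` with `L(E^{d_K},1) ≠ 0`; a Heegner point and its frame over
that `K`; file 2's tower-free UNION. CONDITIONAL on every hypothesis; closes nothing by itself.
[cite: Jetchev2008, Conj. 1.3 and Cor. 1.5 (p. 812)] [cite: MatarNekovar2019, Thm. 0.7 (p. 456) and §0.11 (p. 457)]
[cite: HoffsteinLuo1997, Theorem (§1, pp. 435–436)] [cite: JetchevSkinnerWan2017, §7.4.1 (arXiv:1512.06894 p. 30)]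
[cite: GrossZagier1986, Thm. I.(6.3) and V.§2] -/
theorem bsdp_three_of_classO6_surj_rankOne_of_J3w_of_L3w_of_wAllExclAddWildRankZero
    -- published named facts
    (hGZ : ∀ (N : ℕ) [NeZero N] (W : WeierstrassCurve ℚ) (K : Type) [Field K] [NumberField K],
      gross_zagier N W K)
    (hKo : ∀ (N : ℕ) [NeZero N] (W : WeierstrassCurve ℚ) (K : Type) [Field K] [NumberField K],
      kolyvagin N W K)
    (hGZK : rank_eq_analyticRank_of_analyticRank_le_one) (hmod : hasEntireLFunction_rat)
    (hGZ73 : GrossZagier1986_thm_I_7_3) (hmodN : exists_isNewformOf)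
    (hHL : HoffsteinLuo1997_exists_twist_L_one_ne_zero)
    (hpar : ∀ (W : WeierstrassCurve ℚ), even_analyticRank_iff_rootNumber_eq_one W)
    (hHP : ∀ (W : WeierstrassCurve ℚ) (K : Type) [Field K] [NumberField K], exists_isHeegnerPoint W K)
    (hMN : MatarNekovar2019.thm07_padicValNat_card_sha_primary_add_le_of_globalDivisibility_of_irreducible)
    -- J₃ʷ: the Kolyvagin side (displayed; OPEN)
    (hJ : ∀ (W : WeierstrassCurve ℚ) [W.IsElliptic] [W.IsGloballyMinimal] [NeZero (W.conductorNorm ℤ)]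
      (K : Type) [Field K] [NumberField K] (Dt : ModularParametrizationData W (W.conductorNorm ℤ))
      (H : HeegnerDatum (W.conductorNorm ℤ) (NumberField.discr K)) (ι : K →+* ℂ),
      ClassO6 W 3 → W.HasSurjectiveModNGaloisRep 3 → W.analyticRank = 1 → IsImaginaryQuadratic K →
      Odd (NumberField.discr K) → SatisfiesHeegnerHypothesis (W.conductorNorm ℤ) K →
      (W.quadraticTwist (NumberField.discr K : ℚ)).entireLFunction 1 ≠ 0 →
      ∀ (s' : ℕ), s' ≤ padicValNat 3 W.tamagawaProduct + padicValNat 3 Dt.c.natAbs →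
        ∀ (n : ℕ) (d : KolyvaginHeegnerData Dt H.β ι n), Squarefree n →
          (∀ ℓ ∈ n.primeFactors, Zhang2014.IsKolyvaginPrime (W.conductorNorm ℤ) W K 3 ℓ ∧
            s' ≤ Zhang2014.kolyvaginIndex W 3 ℓ) → Koly.PDiv d 3 s')
    -- L₃ʷ: the IMC side, STEP L at slack v₃(c) (displayed; OPEN)
    (hL : ∀ (W : WeierstrassCurve ℚ) [W.IsElliptic] [W.IsGloballyMinimal] [NeZero (W.conductorNorm ℤ)]
      (K : Type) [Field K] [NumberField K] (Dt : ModularParametrizationData W (W.conductorNorm ℤ))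
      (H : HeegnerDatum (W.conductorNorm ℤ) (NumberField.discr K)) (ι : K →+* ℂ)
      (P : (W.baseChange K).toAffine.Point),
      ClassO6 W 3 → W.HasSurjectiveModNGaloisRep 3 → W.analyticRank = 1 → IsImaginaryQuadratic K →
      Odd (NumberField.discr K) → SatisfiesHeegnerHypothesis (W.conductorNorm ℤ) K →
      (W.quadraticTwist (NumberField.discr K : ℚ)).entireLFunction 1 ≠ 0 →
      WeierstrassCurve.Affine.Point.map ι.toRatAlgHom P = heegnerPointComplex Dt H →
      IndexLowerBoundLeAt W 3 K P (padicValNat 3 Dt.c.natAbs))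
    -- the rank-zero wild leaf
    (hRZ : Summit.BirchSwinnertonDyer.WAllExclAddWildRankZero)
    -- the class
    (W : WeierstrassCurve ℚ) [W.IsElliptic] [W.IsGloballyMinimal]
    (hO6 : ClassO6 W 3) (hsurj : W.HasSurjectiveModNGaloisRep 3) (hr : W.analyticRank = 1) :
    BSDp W 3 := by
  haveI : NeZero (W.conductorNorm ℤ) := ⟨W.conductorNorm_pos_holds.ne'⟩
  -- parity: `r_an = 1` is odd, so `w(E) = -1`
  have hw : W.rootNumber = -1 := by
    rcases W.rootNumber_eq_one_or with h | h
    · exfalso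
      have heven : Even W.analyticRank := (hpar W).mpr h
      rw [hr] at heven
      exact Nat.not_even_one heven
    · exact h
  -- Hoffstein–Luo: an odd Heegner discriminant for `N_E` with `L(E^{d_K},1) ≠ 0`
  obtain ⟨K, _, _, hK, hodd, hHH, -, hLd⟩ :=
    exists_heegnerField_odd_split_twist_ne_zero_of_hoffsteinLuo hmodN hHL W hw 3
  -- the Heegner point over `K` and its frame
  obtain ⟨P, Dt, H, ι, hP⟩ := hHP W K hK hHH
  exact bsdp_three_of_globalDivisibility_of_stepL_of_wAllExclAddWildRankZero_of_surj hGZ hKo hGZK hmod hGZ73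
    hMN hRZ W hO6 hsurj hr K Dt H ι P hK hodd hHH hLd hP (hJ W K Dt H ι hO6 hsurj hr hK hodd hHH hLd)
    (hL W K Dt H ι P hO6 hsurj hr hK hodd hHH hLd hP)

end Summit.BirchSwinnertonDyer.BirchSwinnertonDyer.Theorems.SchneiderFree.Exact

end
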